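import Summits.QuantumFields.BalabanUV.Beta.GAN24.CombContactCauchyAssembly
import Summits.QuantumFields.BalabanUV.Beta.GAN24.CombContactRefineBHolds
import Summits.QuantumFields.BalabanUV.Beta.GAN24.CombContactRefinePThreePack

/-!
# `BalabanUV.Beta.GAN24.CombContactCauchyAssemblyHolds` — row G-an2-4 ∕ (CONV-C), TRANSFER-III, (III′) S-slot (b): **THE (III′) WILSON CONTACT RATE END `hCTd′`, DISCHARGED** —
# the five (III′) two-tower atom ENDs (MY `CombContactRefineBHolds.exists_atomTip∕Mid∕Site_refine_three`, `CombContactRefinePThreePack.exists_pairingAtomTip∕Mid_refine_three`)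
# plugged BY NAME into MY `CombContactCauchyAssembly.exists_comb_contact_supRate_of_atoms`: **THE (III′) WILSON CONTACT TERM OF THE CONJUGATED TOWER, DIFFERENCED ACROSS
# TWO CONSECUTIVE TOWERS IN TABLE UNITS, IS `ϑ^k`-SMALL IN SUP NORM, from `2 ≤ Lc` ALONE** — for every in-block pair of roots (§1), and at the centred roots
# `r = rr = ctrOff 4 Lc` (§2) LITERALLY the hypothesis `hCTd` of road-P2's M.104 `CombSRowsOfContactLetters.exists_hS_hSall_ScombOf_of_contactLetters` — the SECOND of the
# six (b)-letters of the OWNER's END `CombChargeRowsClosed` DISCHARGED (after `hCT` = MY `CombContactAssembly.exists_comb_contact_bound_ctr`).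

NOT IN PRINT; OUR BOOKKEEPING (leaf prover `b2b-balaban-gan24-formalise-leaf-01` gen 89; the (III′) twin of the OWNER gan24-p1 g22's (E) `ContactCauchyAssemblyHolds`;
[folklore] assembly BY NAME; the P-atoms' `AffineAveraging.unitVec` respelled by leaf-02's `ContactOneGaugeCellAlgebra.affine_unitVec_eq`; 0 `def`, 0 cited facts,
0 `def … : Prop`, 0 sorry).  HONEST FRAMING (verbatim): «discharging `BetaPertH` makes Bałaban's UV stability UNCONDITIONAL — a real constructive-QFT result; it is NOT
the continuum limit and NOT the Clay problem.»  HONEST DEPENDENCY (verbatim): «continuum YM on T⁴ ⇐ BetaPertH ∧ nine spine estimates (0/9 proved); BetaPertH ⇐ (D1) ∧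
(D4) ∧ CAP+tail; G-an2-4 gates asym, D1 and NE2/3/4.»  NO estimate of Bałaban's; ONE of M.104's six contact letters — discharges NOTHING of `(hS, hSall)` of `ScombOf` by
itself (four letters `hCg hPc hCv hPcV` remain HYPOTHESES there); 0 wall binders; NEVER «G-an2-4 closed» as (CONV-C); NOT D1, NOT BetaPertH, NOT continuum, NOT Clay.
2026-08-28; no existing file touched.
-/

noncomputable section

open Literature.MathematicalPhysics.QuantumFieldTheory.Balaban1983to89.Beta
open StepJetData (wilsonA)
open AffineAveraging (Site box toSite)
open AveragingContoursRooted (ctr ctrOff ctrOff_mem_box)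
open BalabanCompositeJets (respStep)
open Summit.QuantumFields.BalabanUV.Beta.SymCorrectorKernel (psiKS)
open Summit.QuantumFields.BalabanUV.Beta.GAN24.Push4 (legComp)
open Summit.QuantumFields.BalabanUV.Beta.GAN24.Push4Iter (legChain)
open Summit.QuantumFields.BalabanUV.Beta.GAN24.RespStepBmDecompExact (respStepBmSeq)
open Summit.QuantumFields.BalabanUV.Beta.GAN24.Push3 (push₃)
open Summit.QuantumFields.BalabanUV.Beta.GAN24.ContactOneGaugeCellAlgebra (affine_unitVec_eq)
open Summit.QuantumFields.BalabanUV.Beta.GAN24.CombContactCauchyAssembly (exists_comb_contact_supRate_of_atoms)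
open Summit.QuantumFields.BalabanUV.Beta.GAN24.CombContactRefineBHolds (exists_atomTip_refine_three exists_atomMid_refine_three exists_atomSite_refine_three)
open Summit.QuantumFields.BalabanUV.Beta.GAN24.CombContactRefinePThreePack (exists_pairingAtomTip_refine_three exists_pairingAtomMid_refine_three)

namespace Summit.QuantumFields.BalabanUV.Beta.GAN24.CombContactCauchyAssemblyHolds

variable {Lc : ℕ} [NeZero Lc]

/-! ## §1 Every in-block pair of roots -/

/-- NOT IN PRINT; OUR BOOKKEEPING ([folklore] assembly; UNCONDITIONAL).  **(III′) CT-4e — THE (III′) WILSON CONTACT TERM OF THE CONJUGATED TOWER, DIFFERENCED ACROSS TWO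
CONSECUTIVE TOP-ALIGNED TOWERS IN TABLE UNITS, IS `ϑ^k`-SMALL IN SUP NORM** (`d = 3`, every `Lc ≥ 2`, NO hypothesis beyond it): `∃ K ≥ 0, ϑ ∈ [0,1)` with, for every
in-block pair of roots `r` (of `Ψ̂_S = psiKS r Lc`), `rr` (of the dressing), every `k` and all coarse data `κ₁ u′ x′ z′ α β`,
`|Lc^{12(k+2)}·(push₃ T′³ W − push₃ B′³ W)(κ₁ u′ x′ z′ (inl α) (inl β)) − Lc^{12(k+1)}·(push₃ T³ W − push₃ B³ W)(…)| ≤ K·ϑ^k` (`T = ` the conjugated tower of length `k`,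
`T′` of length `k+1`, `B = respStep 1 (Lc^(k+1))`, `B′ = respStep 1 (Lc^(k+2))`, `W = wilsonA 3`). -/
theorem exists_comb_contact_supRate_three (hLc : 2 ≤ Lc) :
    ∃ K ϑ : ℝ, 0 ≤ K ∧ 0 ≤ ϑ ∧ ϑ < 1 ∧ ∀ (r : Fin (3 + 1) → ℕ), r ∈ box (3 + 1) Lc → ∀ (rr : Fin (3 + 1) → ℕ), rr ∈ box (3 + 1) Lc →
      ∀ (k : ℕ) (κ₁ : Fin (3 + 1)) (u' x' z' : Site (3 + 1)) (α β : Fin (3 + 1)),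
        |(Lc : ℝ) ^ (12 * (k + 2)) *
            (push₃
            (legChain (fun j => legComp (fun α x κ u => psiKS r Lc u x (Sum.inl κ) (Sum.inl α)) (respStepBmSeq (d := 3) (toSite rr) Lc j)) 0 (k + 1))
            (legChain (fun j => legComp (fun α x κ u => psiKS r Lc u x (Sum.inl κ) (Sum.inl α)) (respStepBmSeq (d := 3) (toSite rr) Lc j)) 0 (k + 1))
            (legChain (fun j => legComp (fun α x κ u => psiKS r Lc u x (Sum.inl κ) (Sum.inl α)) (respStepBmSeq (d := 3) (toSite rr) Lc j)) 0 (k + 1))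
            (wilsonA 3) κ₁ u' x' z' (Sum.inl α) (Sum.inl β)
              - push₃ (respStep (d := 3) 1 (Lc ^ (k + 2))) (respStep (d := 3) 1 (Lc ^ (k + 2))) (respStep (d := 3) 1 (Lc ^ (k + 2)))
                (wilsonA 3) κ₁ u' x' z' (Sum.inl α) (Sum.inl β))
          - (Lc : ℝ) ^ (12 * (k + 1)) *
            (push₃
            (legChain (fun j => legComp (fun α x κ u => psiKS r Lc u x (Sum.inl κ) (Sum.inl α)) (respStepBmSeq (d := 3) (toSite rr) Lc j)) 0 k)
            (legChain (fun j => legComp (fun α x κ u => psiKS r Lc u x (Sum.inl κ) (Sum.inl α)) (respStepBmSeq (d := 3) (toSite rr) Lc j)) 0 k)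
            (legChain (fun j => legComp (fun α x κ u => psiKS r Lc u x (Sum.inl κ) (Sum.inl α)) (respStepBmSeq (d := 3) (toSite rr) Lc j)) 0 k)
            (wilsonA 3) κ₁ u' x' z' (Sum.inl α) (Sum.inl β)
              - push₃ (respStep (d := 3) 1 (Lc ^ (k + 1))) (respStep (d := 3) 1 (Lc ^ (k + 1))) (respStep (d := 3) 1 (Lc ^ (k + 1)))
                (wilsonA 3) κ₁ u' x' z' (Sum.inl α) (Sum.inl β))|
          ≤ K * ϑ ^ k := by
  have hPT := exists_pairingAtomTip_refine_three (Lc := Lc) hLc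
  have hPM := exists_pairingAtomMid_refine_three (Lc := Lc) hLc
  simp only [affine_unitVec_eq] at hPT hPM
  exact exists_comb_contact_supRate_of_atoms hLc (exists_atomTip_refine_three hLc) (exists_atomMid_refine_three hLc)
    (exists_atomSite_refine_three hLc) hPT hPM

/-! ## §2 The centred roots — M.104's `hCTd` -/

/-- NOT IN PRINT; OUR BOOKKEEPING.  **THE (III′) WILSON CONTACT RATE END AT THE CENTRED ROOTS `r = rr = ctrOff 4 Lc`** — §1 at the centre (`ctr 4 Lc = toSite (ctrOff 4 Lc)`,
`ctrOff_mem_box`): EXACTLY the hypothesis `hCTd` of road-P2's M.104 `CombSRowsOfContactLetters.exists_hS_hSall_ScombOf_of_contactLetters` (and of MY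
`CombSRowsOfFiveContactLetters.exists_hS_hSall_ScombOf_of_fiveContactLetters`), from `2 ≤ Lc` ALONE — the second of the six (b)-letters of the END `CombChargeRowsClosed`
DISCHARGED. -/
theorem exists_comb_contact_supRate_ctr (hLc : 2 ≤ Lc) :
    ∃ K ϑ : ℝ, 0 ≤ K ∧ 0 ≤ ϑ ∧ ϑ < 1 ∧
      ∀ (k : ℕ) (κ₁ : Fin (3 + 1)) (u' x' z' : Site (3 + 1)) (α β : Fin (3 + 1)),
        |(Lc : ℝ) ^ (12 * (k + 2)) *
            (push₃
            (legChain (fun j => legComp (fun α x κ u => psiKS (ctrOff (3 + 1) Lc) Lc u x (Sum.inl κ) (Sum.inl α)) (respStepBmSeq (d := 3) (ctr (3 + 1) Lc) Lc j)) 0 (k + 1))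
            (legChain (fun j => legComp (fun α x κ u => psiKS (ctrOff (3 + 1) Lc) Lc u x (Sum.inl κ) (Sum.inl α)) (respStepBmSeq (d := 3) (ctr (3 + 1) Lc) Lc j)) 0 (k + 1))
            (legChain (fun j => legComp (fun α x κ u => psiKS (ctrOff (3 + 1) Lc) Lc u x (Sum.inl κ) (Sum.inl α)) (respStepBmSeq (d := 3) (ctr (3 + 1) Lc) Lc j)) 0 (k + 1))
            (wilsonA 3) κ₁ u' x' z' (Sum.inl α) (Sum.inl β)
              - push₃ (respStep (d := 3) 1 (Lc ^ (k + 2))) (respStep (d := 3) 1 (Lc ^ (k + 2))) (respStep (d := 3) 1 (Lc ^ (k + 2)))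
                (wilsonA 3) κ₁ u' x' z' (Sum.inl α) (Sum.inl β))
          - (Lc : ℝ) ^ (12 * (k + 1)) *
            (push₃
            (legChain (fun j => legComp (fun α x κ u => psiKS (ctrOff (3 + 1) Lc) Lc u x (Sum.inl κ) (Sum.inl α)) (respStepBmSeq (d := 3) (ctr (3 + 1) Lc) Lc j)) 0 k)
            (legChain (fun j => legComp (fun α x κ u => psiKS (ctrOff (3 + 1) Lc) Lc u x (Sum.inl κ) (Sum.inl α)) (respStepBmSeq (d := 3) (ctr (3 + 1) Lc) Lc j)) 0 k)
            (legChain (fun j => legComp (fun α x κ u => psiKS (ctrOff (3 + 1) Lc) Lc u x (Sum.inl κ) (Sum.inl α)) (respStepBmSeq (d := 3) (ctr (3 + 1) Lc) Lc j)) 0 k)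
            (wilsonA 3) κ₁ u' x' z' (Sum.inl α) (Sum.inl β)
              - push₃ (respStep (d := 3) 1 (Lc ^ (k + 1))) (respStep (d := 3) 1 (Lc ^ (k + 1))) (respStep (d := 3) 1 (Lc ^ (k + 1)))
                (wilsonA 3) κ₁ u' x' z' (Sum.inl α) (Sum.inl β))|
          ≤ K * ϑ ^ k := by
  obtain ⟨K, ϑ, hK, hϑ0, hϑ1, h⟩ := exists_comb_contact_supRate_three (Lc := Lc) hLc
  have hc : ctrOff (3 + 1) Lc ∈ box (3 + 1) Lc := ctrOff_mem_box (by omega)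
  exact ⟨K, ϑ, hK, hϑ0, hϑ1, fun k κ₁ u' x' z' α β => h _ hc _ hc k κ₁ u' x' z' α β⟩

end Summit.QuantumFields.BalabanUV.Beta.GAN24.CombContactCauchyAssemblyHolds

end
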